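import Summits.QuantumAdvantage.QuantumAdvantage.Theorems.WalkFiniteStateRungSparse

/-!
# Rung (G) `Coset21.TwoStepFiniteStateWalkHard 5` — part 6/6 — §9 (second half): `fibre_bound`, `stub_sparse`, and the closing theorems `twoStepFiniteStateWalkHard_five` (= item stmt-QuantumAdvantage-28072) and `twoStepFiniteStateWalkHard_of_prime`

VERBATIM split (for the 400-line rule) of planner qa-qnc0-p2 g22's `HOME/qa-qnc0-p2/line22/RungGCore.lean` v3 (sha16 `70defc48ef50f6ad`;
authored AND proved by the planner seat; landed by qn-prover-3 g14, ask P2-22d, `--supports stmt-QuantumAdvantage-28072`).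
(+ one-line docstrings on undocumented auxiliaries, lint.)  See `WalkFiniteStateRungContraction.lean` for the planner's docstring.  WHAT THIS IS NOT: nothing about polynomial
strategies or `LinSel`; separation NOT moved.
-/

noncomputable section

namespace Summit.QuantumAdvantage.AdviceFreeQNC0

namespace Coset21

namespace RungG

open Finset

variable {M : ℕ}

section Sparse

variable {p : ℕ} {M : ℕ}

variable {a q : ℕ}

/-- **Per-fibre bound**: on the fibre `(uA, uB)` of a free window, `#win ≤ (2/3 + ε) · #class`. -/
theorem fibre_bound [Fact p.Prime] (hM : M + 1 = 3 * p) (hp3 : ¬ 3 ∣ p) {m : ℕ} (hm : 0 < m) (c : ℕ)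
    (T : Fin (a + m + q + 1) → ZMod p → ZMod p → Bool) (w : ZMod p)
    (hfree : ∀ g : Fin (a + m + q + 1), a < g.val → g.val < a + m → ¬ Active T w g)
    (uA : Fin a → Bool) (uB : Fin q → Bool) (ρ ε : ℝ) (hρ : 0 ≤ ρ) (hε : 0 < ε) (hε3 : ε ≤ 1 / 3)
    (hE : ∀ r : ZMod (M + 1),
      |((((univ : Finset (Fin m → Bool)).filter fun v => ((wt v : ℕ) : ZMod (M + 1)) = r).card : ℕ) : ℝ)
          - (2 : ℝ) ^ m / ((M + 1 : ℕ) : ℝ)| ≤ ρ ^ m * (2 : ℝ) ^ m)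
    (hρm : 2 * p * ρ ^ m ≤ ε) :
    (((univ : Finset (Fin m → Bool)).filter fun v =>
        ringWinU c (yOf T) (glue3 uA v uB) = true ∧ ((wt (glue3 uA v uB) : ℕ) : ZMod p) = w).card : ℝ)
      ≤ (2 / 3 + ε) * (((univ : Finset (Fin m → Bool)).filter fun v =>
          ((wt (glue3 uA v uB) : ℕ) : ZMod p) = w).card : ℝ) := by
  classical
  haveI : NeZero p := ⟨(Fact.out : p.Prime).ne_zero⟩
  have hp_pos : 0 < p := (Fact.out : p.Prime).pos
  -- the residue `k₀` forced on the window weight, and its lifts `L j`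
  set k₀ : ZMod p := w - ((wt uA : ℕ) : ZMod p) - ((wt uB : ℕ) : ZMod p) with hk₀
  set L : ℕ → ZMod (M + 1) := fun j => ((k₀.val : ℕ) : ZMod (M + 1)) + ((j * p : ℕ) : ZMod (M + 1)) with hL
  set N : ZMod (M + 1) → ℕ := fun r => ((univ : Finset (Fin m → Bool)).filter fun v => ((wt v : ℕ) : ZMod (M + 1)) = r).card
    with hN
  set CL := (univ : Finset (Fin m → Bool)).filter fun v => ((wt (glue3 uA v uB) : ℕ) : ZMod p) = w with hCL
  set WN := (univ : Finset (Fin m → Bool)).filter fun v =>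
    ringWinU c (yOf T) (glue3 uA v uB) = true ∧ ((wt (glue3 uA v uB) : ℕ) : ZMod p) = w with hWN
  -- class condition on the fibre = condition on the window residue
  have hclass : ∀ v : Fin m → Bool, ((wt (glue3 uA v uB) : ℕ) : ZMod p) = w ↔ proj hM (((wt v : ℕ) : ZMod (M + 1))) = k₀ := by
    intro v
    rw [proj_natCast, wt_glue3, hk₀]; push_cast
    constructor
    · intro h; rw [← h]; ring
    · intro h; rw [h]; ring
  have hclass' : ∀ v : Fin m → Bool, ((wt (glue3 uA v uB) : ℕ) : ZMod p) = w →
      proj hM (((wt (glue3 uA v uB) : ℕ) : ZMod (M + 1))) = w := by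
    intro v h; rw [proj_natCast]; exact h
  -- (1) `#class ≤ Σ_{j<3} N (L j) ≤ 3 (X + E)`
  have hCLsub : CL ⊆ (Finset.range 3).biUnion fun j => (univ : Finset (Fin m → Bool)).filter fun v =>
      ((wt v : ℕ) : ZMod (M + 1)) = L j := by
    intro v hv
    rw [hCL, Finset.mem_filter] at hv
    obtain ⟨j, hj, hjr⟩ := exists_lift_eq hM k₀ _ ((hclass v).mp hv.2)
    rw [Finset.mem_biUnion]
    exact ⟨j, Finset.mem_range.mpr hj, by rw [Finset.mem_filter]; exact ⟨Finset.mem_univ _, hjr⟩⟩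
  have hCLle : (CL.card : ℝ) ≤ (N (L 0) : ℝ) + N (L 1) + N (L 2) := by
    have h := (Finset.card_le_card hCLsub).trans Finset.card_biUnion_le
    simp only [Finset.sum_range_succ, Finset.sum_range_zero, zero_add] at h
    exact_mod_cast h
  -- (2) a non-winning lift `L j₀` and `#win ≤ #class − N (L j₀)`
  have hnot := not_winR_all_three hM hp3 m c T w uA uB ((k₀.val : ℕ) : ZMod (M + 1))
  simp only [not_forall] at hnot
  obtain ⟨j₀, hj₀, hW₀⟩ := hnot
  set S₀ := (univ : Finset (Fin m → Bool)).filter fun v => ((wt v : ℕ) : ZMod (M + 1)) = L j₀ with hS₀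
  have hS₀sub : S₀ ⊆ CL := by
    intro v hv
    rw [hS₀, Finset.mem_filter] at hv
    rw [hCL, Finset.mem_filter]
    refine ⟨Finset.mem_univ _, (hclass v).mpr ?_⟩
    rw [hv.2]; exact proj_lift hM k₀ j₀
  have hWNsub : WN ⊆ CL \ S₀ := by
    intro v hv
    rw [hWN, Finset.mem_filter] at hv
    rw [Finset.mem_sdiff]
    refine ⟨by rw [hCL, Finset.mem_filter]; exact ⟨Finset.mem_univ _, hv.2.2⟩, ?_⟩
    intro hv0
    rw [hS₀, Finset.mem_filter] at hv0
    have hwin := (ringWinU_glue3_iff_winR hM hm c T w hfree uA v uB (hclass' v hv.2.2)).mp hv.2.1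
    rw [hv0.2] at hwin
    exact hW₀ hwin
  have hWNle : (WN.card : ℝ) ≤ (CL.card : ℝ) - N (L j₀) := by
    have h1 : WN.card ≤ CL.card - S₀.card := by
      calc WN.card ≤ (CL \ S₀).card := Finset.card_le_card hWNsub
        _ = CL.card - S₀.card := Finset.card_sdiff_of_subset hS₀sub
    have h2 : S₀.card ≤ CL.card := Finset.card_le_card hS₀sub
    have h3 : (WN.card : ℝ) ≤ ((CL.card - S₀.card : ℕ) : ℝ) := by exact_mod_cast h1
    rw [Nat.cast_sub h2] at h3
    exact h3
  -- (3) the Equidist counts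
  set X : ℝ := (2 : ℝ) ^ m / ((M + 1 : ℕ) : ℝ) with hX
  set E : ℝ := ρ ^ m * (2 : ℝ) ^ m with hEdef
  have hNlo : ∀ r, X - E ≤ (N r : ℝ) := fun r => by have := (abs_le.mp (hE r)).1; simp only [hN]; linarith
  have hNhi : ∀ r, (N r : ℝ) ≤ X + E := fun r => by have := (abs_le.mp (hE r)).2; simp only [hN]; linarith
  have hEnn : 0 ≤ E := by positivity
  have hXval : X = (2 : ℝ) ^ m / (3 * p) := by rw [hX, hM]; push_cast; ring
  have hE2 : 2 * E ≤ 3 * ε * X := by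
    rw [hXval, hEdef]
    have h2m : (0 : ℝ) < (2 : ℝ) ^ m := by positivity
    have hp' : (0 : ℝ) < p := by exact_mod_cast hp_pos
    have := mul_le_mul_of_nonneg_right hρm h2m.le
    rw [show 3 * ε * ((2 : ℝ) ^ m / (3 * p)) = ε * (2 : ℝ) ^ m / p by field_simp]
    rw [le_div_iff₀ hp']
    nlinarith
  have hC3 : (CL.card : ℝ) ≤ 3 * (X + E) := by linarith [hCLle, hNhi (L 0), hNhi (L 1), hNhi (L 2)]
  have hW : (WN.card : ℝ) ≤ (CL.card : ℝ) - X + E := by linarith [hWNle, hNlo (L j₀)]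
  have hCnn : (0 : ℝ) ≤ CL.card := by positivity
  have h13 : (0 : ℝ) ≤ 1 / 3 - ε := by linarith
  nlinarith [mul_nonneg h13 (by linarith : (0 : ℝ) ≤ 3 * (X + E) - CL.card), mul_nonneg hε.le hEnn]

end Sparse

/-- **Lemma 2 + 3 (`stub_sparse`)**: the sparse-active relative bound, from `Equidist` at modulus `3p`. -/
theorem stub_sparse (p : ℕ) [Fact p.Prime] (hp : 5 ≤ p) : Equidist → SparseBound p := by
  classical
  intro hEq ε hε
  have hM : 3 * p - 1 + 1 = 3 * p := by omega
  have hp3 : ¬ 3 ∣ p := by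
    intro h
    have := (Nat.Prime.eq_one_or_self_of_dvd (Fact.out : p.Prime) 3 h)
    omega
  have hp_pos : 0 < p := by omega
  obtain ⟨ρ, hρ0, hρ1, hE⟩ := hEq (3 * p - 1 + 1) (by omega)
  -- work with `ε' = min ε (1/3)`
  set ε' : ℝ := min ε (1 / 3) with hε'
  have hε'0 : 0 < ε' := lt_min hε (by norm_num)
  have hε'3 : ε' ≤ 1 / 3 := min_le_right _ _
  have hε'le : ε' ≤ ε := min_le_left _ _
  -- choose the window length
  have hp' : (0 : ℝ) < p := by exact_mod_cast hp_pos
  obtain ⟨m₀, hm₀⟩ := exists_pow_lt_of_lt_one (show (0 : ℝ) < ε' / (2 * p) by positivity) hρ1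
  refine ⟨m₀ + 1, Nat.succ_pos _, fun n c T w hAm => ?_⟩
  have hρm : 2 * p * ρ ^ (m₀ + 1) ≤ ε' := by
    have h1 : ρ ^ (m₀ + 1) ≤ ρ ^ m₀ := by
      rw [pow_succ]; exact mul_le_of_le_one_right (pow_nonneg hρ0 _) hρ1.le
    have h2 : ρ ^ (m₀ + 1) < ε' / (2 * p) := h1.trans_lt hm₀
    rw [lt_div_iff₀ (by positivity)] at h2
    linarith
  obtain ⟨a, ham, hfree⟩ := exists_free_window T w hAm
  obtain ⟨q, hq⟩ : ∃ q, n = a + (m₀ + 1) + q := ⟨n - (a + (m₀ + 1)), by omega⟩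
  subst hq
  -- decompose both counts over the fibres `(uA, uB)`
  have hwin : (winIn c T w).card = ∑ uA : Fin a → Bool, ∑ uB : Fin q → Bool,
      ((univ : Finset (Fin (m₀ + 1) → Bool)).filter fun v =>
        ringWinU c (yOf T) (glue3 uA v uB) = true ∧ ((wt (glue3 uA v uB) : ℕ) : ZMod p) = w).card := by
    unfold winIn
    rw [Finset.filter_filter]
    exact card_filter_eq_sum_glue3 _
  have hcl : (classOf p w : Finset (Fin (a + (m₀ + 1) + q) → Bool)).card = ∑ uA : Fin a → Bool, ∑ uB : Fin q → Bool,
      ((univ : Finset (Fin (m₀ + 1) → Bool)).filter fun v => ((wt (glue3 uA v uB) : ℕ) : ZMod p) = w).card := by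
    unfold classOf
    exact card_filter_eq_sum_glue3 _
  rw [hwin, hcl]
  push_cast
  rw [Finset.mul_sum]
  refine Finset.sum_le_sum fun uA _ => ?_
  rw [Finset.mul_sum]
  refine Finset.sum_le_sum fun uB _ => ?_
  have hfib := fibre_bound hM hp3 (Nat.succ_pos m₀) c T w hfree uA uB ρ ε' hρ0 hε'0 hε'3 (hE (m₀ + 1)) hρm
  refine hfib.trans ?_
  have hnn : (0 : ℝ) ≤ (((univ : Finset (Fin (m₀ + 1) → Bool)).filter fun v =>
      ((wt (glue3 uA v uB) : ℕ) : ZMod p) = w).card : ℝ) := by positivity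
  nlinarith

/-- **Rung (G)** (`stmt-QuantumAdvantage-28072`, `OddPrimeWalk.FiniteStateRungFive`): the two-step finite-state walk bound at
`p = 5`, unconditionally — the closing theorem; its type is literally the item's signature `Coset21.TwoStepFiniteStateWalkHard 5`. -/
theorem twoStepFiniteStateWalkHard_five : TwoStepFiniteStateWalkHard 5 :=
  haveI : Fact (Nat.Prime 5) := ⟨by norm_num⟩
  twoStepFiniteStateWalkHard_five_of_sparse (stub_sparse 5 le_rfl)

/-- The same bound for every prime `p ≥ 5` (both moduli coprime to `6`). -/
theorem twoStepFiniteStateWalkHard_of_prime (p : ℕ) [Fact p.Prime] (hp : 5 ≤ p) : TwoStepFiniteStateWalkHard p :=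
  twoStepFiniteStateWalkHard_of_sparse p hp (stub_sparse p hp)

end RungG

end Coset21

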